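import Mathlib
import Summits.PneNP.PneNP.Theorems.ConvexRankGatesConvexGateBlindMonoMoment

/-!
# PneNP / ConvexRankGates — `ConvexGateBlind`: averaged clique-non-negativity over near-transversal `k`-sets (matrix form)

Helpers (`--supports stmt-PneNP-10680`), COLUMN-SPACE line (prover seat 2, session 16): the averaging identities behind the
REALISATION LEMMA (`…CondPositivity.lean`) of the second-generation catch bound.

Let `V` be a symmetric zero-diagonal matrix on `Fin m` (the edge weighting `v{x,y} = V x y` of the line) which is
`k`-CLIQUE-NON-NEGATIVE: `∑_{x,y ∈ Q} V x y ≥ 0` for every `k`-set `Q`. Fix ANY vertex set `H` ("hubs") with complement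
`S = Hᶜ` of size `s ≥ k`, and write

  `T₀ = ½ ∑_{x,y ∈ S} V x y`  (mass inside `S`),   `T₁(a) = ∑_{y ∈ S} V a y`  (mass from `a ∈ H` into `S`),
  `mass_out = T₀ + ∑_{a ∈ H} T₁(a) = ½∑∑ V − ½∑_{H×H} V`   (mass of the pairs NOT inside `H`),
  `neg_H = ½ ∑_{a,b ∈ H} max(−V a b, 0)`  (negative mass inside `H`).

Averaging the validity inequality over the near-transversal `k`-sets `B`, `{a} ∪ B`, `{a,b} ∪ B` (`B ⊆ S`) gives
(`sum_valid_powersetCard`, `sum_valid_insert`, `sum_valid_insert_insert`)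

  (I0) `T₀ ≥ 0`,  (I1) `T₁(a) + ((k−2)/(s−1))·T₀ ≥ 0`,  (I2) `V a b + ((k−2)/s)(T₁(a)+T₁(b)) + ((k−2)(k−3)/(s(s−1)))·T₀ ≥ 0`,

in summed form (this file: the counting lemmas `card_filter_powersetCard_superset_of_subset`, `sum_powersetCard_sum_sum`,
`sum_powersetCard_sum`, and the Pascal absorption identities `cast_pred_mul_choose`, `cast_mul_choose_pred` used to
normalise them). [new; elementary averaging]
-/

set_option linter.dupNamespace false

namespace Summit.PneNP.PneNP.Theorems

open Finset

noncomputable section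

variable {m : ℕ}

/-! ## Counting subsets of a ground set through given vertices -/

/-- The `r`-subsets of a finset `S` containing `A ⊆ S` number `C(#S − #A, r − #A)` (`#A ≤ r`). [folklore] -/
theorem card_filter_powersetCard_superset_of_subset (S A : Finset (Fin m)) (hAS : A ⊆ S) {r : ℕ} (hr : A.card ≤ r) :
    ((S.powersetCard r).filter (fun B => A ⊆ B)).card = Nat.choose (S.card - A.card) (r - A.card) := by
  classical
  have hSA : (S \ A).card = S.card - A.card := card_sdiff_of_subset hAS
  rw [← hSA, ← card_powersetCard (r - A.card) (S \ A)]
  refine card_bij (fun B _ => B \ A) (fun B hB => ?_) (fun B₁ hB₁ B₂ hB₂ h => ?_) (fun T hT => ?_)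
  · rw [mem_filter, mem_powersetCard] at hB
    rw [mem_powersetCard]
    refine ⟨sdiff_subset_sdiff hB.1.1 subset_rfl, ?_⟩
    rw [card_sdiff_of_subset hB.2, hB.1.2]
  · rw [mem_filter] at hB₁ hB₂
    rw [← union_sdiff_of_subset hB₁.2, ← union_sdiff_of_subset hB₂.2, h]
  · rw [mem_powersetCard] at hT
    have hdisj : Disjoint T A := by
      rw [Finset.disjoint_left]
      intro v hvT hvA
      exact (mem_sdiff.1 (hT.1 hvT)).2 hvA
    refine ⟨T ∪ A, ?_, ?_⟩
    · rw [mem_filter, mem_powersetCard]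
      refine ⟨⟨union_subset (fun v hv => (mem_sdiff.1 (hT.1 hv)).1) hAS, ?_⟩, subset_union_right⟩
      rw [card_union_of_disjoint hdisj, hT.2]
      omega
    · rw [union_sdiff_right, Finset.sdiff_eq_self_iff_disjoint]
      exact hdisj

/-- `∑_{B ∈ C(S,r)} 𝟙[x ∈ B] 𝟙[y ∈ B] = C(s−2, r−2)` for `x ≠ y` in `S` (`2 ≤ r`). [folklore] -/
theorem sum_powersetCard_ite_mem_mem (S : Finset (Fin m)) {x y : Fin m} (hx : x ∈ S) (hy : y ∈ S) (hxy : x ≠ y)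
    {r : ℕ} (hr : 2 ≤ r) :
    ∑ B ∈ S.powersetCard r, (if x ∈ B ∧ y ∈ B then (1 : ℝ) else 0) = (Nat.choose (S.card - 2) (r - 2) : ℝ) := by
  classical
  have hpair : ({x, y} : Finset (Fin m)).card = 2 := card_pair hxy
  have hsub : ({x, y} : Finset (Fin m)) ⊆ S := by
    rw [insert_subset_iff, singleton_subset_iff]; exact ⟨hx, hy⟩
  have h := card_filter_powersetCard_superset_of_subset S {x, y} hsub (r := r) (by rw [hpair]; exact hr)
  rw [hpair] at h
  calc ∑ B ∈ S.powersetCard r, (if x ∈ B ∧ y ∈ B then (1 : ℝ) else 0)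
      = ∑ B ∈ S.powersetCard r, (if ({x, y} : Finset (Fin m)) ⊆ B then (1 : ℝ) else 0) :=
        Finset.sum_congr rfl fun B _ => by simp only [insert_subset_iff, singleton_subset_iff]
    _ = ((((S.powersetCard r).filter (fun B => ({x, y} : Finset (Fin m)) ⊆ B)).card : ℕ) : ℝ) := by
        rw [Finset.sum_boole]
    _ = (Nat.choose (S.card - 2) (r - 2) : ℝ) := by rw [h]

/-- `∑_{B ∈ C(S,r)} 𝟙[y ∈ B] = C(s−1, r−1)` for `y ∈ S` (`1 ≤ r`). [folklore] -/
theorem sum_powersetCard_ite_mem (S : Finset (Fin m)) {y : Fin m} (hy : y ∈ S) {r : ℕ} (hr : 1 ≤ r) :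
    ∑ B ∈ S.powersetCard r, (if y ∈ B then (1 : ℝ) else 0) = (Nat.choose (S.card - 1) (r - 1) : ℝ) := by
  classical
  have h := card_filter_powersetCard_superset_of_subset S {y} (singleton_subset_iff.2 hy) (r := r)
    (by rw [card_singleton]; exact hr)
  rw [card_singleton] at h
  calc ∑ B ∈ S.powersetCard r, (if y ∈ B then (1 : ℝ) else 0)
      = ∑ B ∈ S.powersetCard r, (if ({y} : Finset (Fin m)) ⊆ B then (1 : ℝ) else 0) :=
        Finset.sum_congr rfl fun B _ => by simp only [singleton_subset_iff]
    _ = ((((S.powersetCard r).filter (fun B => ({y} : Finset (Fin m)) ⊆ B)).card : ℕ) : ℝ) := by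
        rw [Finset.sum_boole]
    _ = (Nat.choose (S.card - 1) (r - 1) : ℝ) := by rw [h]

/-- **Averaging a pair sum over the `r`-subsets of `S`.** For `G` with zero diagonal and `2 ≤ r`:
`∑_{B ∈ C(S,r)} ∑_{x,y ∈ B} G x y = C(s−2,r−2) · ∑_{x,y ∈ S} G x y`. [folklore] -/
theorem sum_powersetCard_sum_sum (S : Finset (Fin m)) (G : Fin m → Fin m → ℝ) (hG0 : ∀ x, G x x = 0)
    {r : ℕ} (hr : 2 ≤ r) :
    ∑ B ∈ S.powersetCard r, ∑ x ∈ B, ∑ y ∈ B, G x y =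
      (Nat.choose (S.card - 2) (r - 2) : ℝ) * ∑ x ∈ S, ∑ y ∈ S, G x y := by
  classical
  -- write the inner sums over `S` with indicators
  have hin : ∀ B ∈ S.powersetCard r, ∑ x ∈ B, ∑ y ∈ B, G x y =
      ∑ x ∈ S, ∑ y ∈ S, (if x ∈ B ∧ y ∈ B then (1 : ℝ) else 0) * G x y := by
    intro B hB
    have hBS : B ⊆ S := (mem_powersetCard.1 hB).1
    have hx : ∀ x ∈ S, ∑ y ∈ S, (if x ∈ B ∧ y ∈ B then (1 : ℝ) else 0) * G x y =
        if x ∈ B then ∑ y ∈ B, G x y else 0 := by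
      intro x _
      by_cases hxB : x ∈ B
      · rw [if_pos hxB]
        have : ∀ y ∈ S, (if x ∈ B ∧ y ∈ B then (1 : ℝ) else 0) * G x y = if y ∈ B then G x y else 0 := by
          intro y _
          by_cases hyB : y ∈ B
          · rw [if_pos ⟨hxB, hyB⟩, if_pos hyB, one_mul]
          · rw [if_neg (fun h => hyB h.2), if_neg hyB, zero_mul]
        rw [Finset.sum_congr rfl this, Finset.sum_ite_mem, inter_eq_right.2 hBS]
      · rw [if_neg hxB]
        exact Finset.sum_eq_zero fun y _ => by rw [if_neg (fun h => hxB h.1), zero_mul]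
    rw [Finset.sum_congr rfl hx, Finset.sum_ite_mem, inter_eq_right.2 hBS]
  rw [Finset.sum_congr rfl hin, Finset.sum_comm]
  rw [Finset.mul_sum]
  refine Finset.sum_congr rfl fun x hx => ?_
  rw [Finset.sum_comm, Finset.mul_sum]
  refine Finset.sum_congr rfl fun y hy => ?_
  rw [← Finset.sum_mul]
  by_cases hxy : x = y
  · subst hxy
    rw [hG0, mul_zero, mul_zero]
  · rw [sum_powersetCard_ite_mem_mem S hx hy hxy hr]

/-- **Averaging a vertex sum over the `r`-subsets of `S`.** For `1 ≤ r`: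
`∑_{B ∈ C(S,r)} ∑_{y ∈ B} g y = C(s−1,r−1) · ∑_{y ∈ S} g y`. [folklore] -/
theorem sum_powersetCard_sum (S : Finset (Fin m)) (g : Fin m → ℝ) {r : ℕ} (hr : 1 ≤ r) :
    ∑ B ∈ S.powersetCard r, ∑ y ∈ B, g y = (Nat.choose (S.card - 1) (r - 1) : ℝ) * ∑ y ∈ S, g y := by
  classical
  have hin : ∀ B ∈ S.powersetCard r, ∑ y ∈ B, g y = ∑ y ∈ S, (if y ∈ B then (1 : ℝ) else 0) * g y := by
    intro B hB
    have hBS : B ⊆ S := (mem_powersetCard.1 hB).1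
    have : ∀ y ∈ S, (if y ∈ B then (1 : ℝ) else 0) * g y = if y ∈ B then g y else 0 := by
      intro y _
      split_ifs <;> simp
    rw [Finset.sum_congr rfl this, Finset.sum_ite_mem, inter_eq_right.2 hBS]
  rw [Finset.sum_congr rfl hin, Finset.sum_comm, Finset.mul_sum]
  refine Finset.sum_congr rfl fun y hy => ?_
  rw [← Finset.sum_mul, sum_powersetCard_ite_mem S hy hr]

/-! ## The three averaged validity inequalities -/

variable {k : ℕ}

/-- **(I0), summed form.** Validity averaged over the `k`-subsets of `S`:
`0 ≤ C(s−2,k−2) · ∑_{x,y ∈ S} V x y`. [new; elementary] -/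
theorem sum_valid_powersetCard (V : Fin m → Fin m → ℝ) (hV0 : ∀ x, V x x = 0) (hk : 2 ≤ k)
    (hvalid : ∀ Q ∈ (Finset.univ : Finset (Fin m)).powersetCard k, 0 ≤ ∑ x ∈ Q, ∑ y ∈ Q, V x y)
    (S : Finset (Fin m)) :
    0 ≤ (Nat.choose (S.card - 2) (k - 2) : ℝ) * ∑ x ∈ S, ∑ y ∈ S, V x y := by
  rw [← sum_powersetCard_sum_sum S V hV0 hk]
  refine Finset.sum_nonneg fun B hB => hvalid B ?_
  rw [mem_powersetCard] at hB ⊢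
  exact ⟨subset_univ _, hB.2⟩

/-- **(I1), summed form.** Validity averaged over the `k`-sets `{a} ∪ B`, `B` a `(k−1)`-subset of `S` (`a ∉ S`, `V`
symmetric with zero diagonal, `3 ≤ k`):
`0 ≤ C(s−2,k−3) · ∑_{x,y ∈ S} V x y + 2·C(s−1,k−2) · ∑_{y ∈ S} V a y`. [new; elementary] -/
theorem sum_valid_insert (V : Fin m → Fin m → ℝ) (hV : ∀ x y, V x y = V y x) (hV0 : ∀ x, V x x = 0) (hk : 3 ≤ k)
    (hvalid : ∀ Q ∈ (Finset.univ : Finset (Fin m)).powersetCard k, 0 ≤ ∑ x ∈ Q, ∑ y ∈ Q, V x y)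
    (S : Finset (Fin m)) {a : Fin m} (ha : a ∉ S) :
    0 ≤ (Nat.choose (S.card - 2) (k - 3) : ℝ) * ∑ x ∈ S, ∑ y ∈ S, V x y +
      2 * (Nat.choose (S.card - 1) (k - 2) : ℝ) * ∑ y ∈ S, V a y := by
  classical
  have hsum : ∑ B ∈ S.powersetCard (k - 1), ∑ x ∈ insert a B, ∑ y ∈ insert a B, V x y =
      ∑ B ∈ S.powersetCard (k - 1), ((∑ x ∈ B, ∑ y ∈ B, V x y) + ∑ u ∈ B, (2 * V a u)) := by
    refine Finset.sum_congr rfl fun B hB => ?_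
    have haB : a ∉ B := fun h => ha ((mem_powersetCard.1 hB).1 h)
    rw [sum_sum_insert_eq V haB, hV0, add_zero]
    congr 1
    exact Finset.sum_congr rfl fun u _ => by rw [hV u a]; ring
  have h1 : (S.card - 2).choose (k - 1 - 2) = (S.card - 2).choose (k - 3) := by congr 1
  have h2 : (S.card - 1).choose (k - 1 - 1) = (S.card - 1).choose (k - 2) := by congr 1
  have hval : 0 ≤ ∑ B ∈ S.powersetCard (k - 1), ∑ x ∈ insert a B, ∑ y ∈ insert a B, V x y := by
    refine Finset.sum_nonneg fun B hB => hvalid _ ?_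
    rw [mem_powersetCard] at hB ⊢
    have haB : a ∉ B := fun h => ha (hB.1 h)
    refine ⟨subset_univ _, ?_⟩
    rw [card_insert_of_notMem haB, hB.2]
    omega
  rw [hsum, Finset.sum_add_distrib, sum_powersetCard_sum_sum S V hV0 (by omega : 2 ≤ k - 1),
    sum_powersetCard_sum S (fun u => 2 * V a u) (by omega : 1 ≤ k - 1), h1, h2, ← Finset.mul_sum] at hval
  linarith

/-- **(I2), summed form.** Validity averaged over the `k`-sets `{a,b} ∪ B`, `B` a `(k−2)`-subset of `S` (`a ≠ b` outside `S`,
`4 ≤ k`): `0 ≤ C(s−2,k−4)·∑_{x,y∈S} V + 2C(s−1,k−3)·(∑_{y∈S} V a y + ∑_{y∈S} V b y) + 2C(s,k−2)·V a b`. [new; elementary] -/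
theorem sum_valid_insert_insert (V : Fin m → Fin m → ℝ) (hV : ∀ x y, V x y = V y x) (hV0 : ∀ x, V x x = 0)
    (hk : 4 ≤ k) (hvalid : ∀ Q ∈ (Finset.univ : Finset (Fin m)).powersetCard k, 0 ≤ ∑ x ∈ Q, ∑ y ∈ Q, V x y)
    (S : Finset (Fin m)) {a b : Fin m} (ha : a ∉ S) (hb : b ∉ S) (hab : a ≠ b) :
    0 ≤ (Nat.choose (S.card - 2) (k - 4) : ℝ) * ∑ x ∈ S, ∑ y ∈ S, V x y +
      2 * (Nat.choose (S.card - 1) (k - 3) : ℝ) * (∑ y ∈ S, V a y + ∑ y ∈ S, V b y) +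
      2 * (Nat.choose S.card (k - 2) : ℝ) * V a b := by
  classical
  have hsum : ∑ B ∈ S.powersetCard (k - 2), ∑ x ∈ insert a (insert b B), ∑ y ∈ insert a (insert b B), V x y =
      ∑ B ∈ S.powersetCard (k - 2),
        (((∑ x ∈ B, ∑ y ∈ B, V x y) + ∑ u ∈ B, (2 * V a u + 2 * V b u)) + 2 * V a b) := by
    refine Finset.sum_congr rfl fun B hB => ?_
    have haB : a ∉ B := fun h => ha ((mem_powersetCard.1 hB).1 h)
    have hbB : b ∉ B := fun h => hb ((mem_powersetCard.1 hB).1 h)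
    have habB : a ∉ insert b B := by
      rw [mem_insert, not_or]; exact ⟨hab, haB⟩
    rw [sum_sum_insert_eq V habB, hV0, add_zero, sum_sum_insert_eq V hbB, hV0, add_zero,
      Finset.sum_insert hbB, hV b a]
    have e1 : ∑ u ∈ B, (V u a + V a u) = ∑ u ∈ B, 2 * V a u :=
      Finset.sum_congr rfl fun u _ => by rw [hV u a]; ring
    have e2 : ∑ u ∈ B, (V u b + V b u) = ∑ u ∈ B, 2 * V b u :=
      Finset.sum_congr rfl fun u _ => by rw [hV u b]; ring
    rw [e1, e2]
    have e3 : ∑ u ∈ B, (2 * V a u + 2 * V b u) = ∑ u ∈ B, 2 * V a u + ∑ u ∈ B, 2 * V b u :=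
      Finset.sum_add_distrib
    rw [e3]
    ring
  have h1 : (S.card - 2).choose (k - 2 - 2) = (S.card - 2).choose (k - 4) := by congr 1
  have h2 : (S.card - 1).choose (k - 2 - 1) = (S.card - 1).choose (k - 3) := by congr 1
  have hval : 0 ≤ ∑ B ∈ S.powersetCard (k - 2), ∑ x ∈ insert a (insert b B), ∑ y ∈ insert a (insert b B), V x y := by
    refine Finset.sum_nonneg fun B hB => hvalid _ ?_
    rw [mem_powersetCard] at hB ⊢
    have haB : a ∉ B := fun h => ha (hB.1 h)
    have hbB : b ∉ B := fun h => hb (hB.1 h)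
    have habB : a ∉ insert b B := by
      rw [mem_insert, not_or]; exact ⟨hab, haB⟩
    refine ⟨subset_univ _, ?_⟩
    rw [card_insert_of_notMem habB, card_insert_of_notMem hbB, hB.2]
    omega
  rw [hsum, Finset.sum_add_distrib, Finset.sum_add_distrib, sum_powersetCard_sum_sum S V hV0 (by omega : 2 ≤ k - 2),
    sum_powersetCard_sum S (fun u => 2 * V a u + 2 * V b u) (by omega : 1 ≤ k - 2), h1, h2,
    Finset.sum_const, card_powersetCard, nsmul_eq_mul] at hval
  have e : ∑ u ∈ S, (2 * V a u + 2 * V b u) = 2 * (∑ y ∈ S, V a y + ∑ y ∈ S, V b y) := by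
    rw [Finset.sum_add_distrib, ← Finset.mul_sum, ← Finset.mul_sum]; ring
  rw [e] at hval
  linarith

/-- **Near-transversal averaging** (registered form of `sum_valid_insert_insert`). [new] -/
theorem nearTransversal_average : ∀ {m k : ℕ} (V : Fin m → Fin m → ℝ), (∀ x y, V x y = V y x) → (∀ x, V x x = 0) → 4 ≤ k → (∀ Q ∈ (Finset.univ : Finset (Fin m)).powersetCard k, 0 ≤ ∑ x ∈ Q, ∑ y ∈ Q, V x y) → ∀ (S : Finset (Fin m)) (a b : Fin m), a ∉ S → b ∉ S → a ≠ b → 0 ≤ (Nat.choose (S.card - 2) (k - 4) : ℝ) * ∑ x ∈ S, ∑ y ∈ S, V x y + 2 * (Nat.choose (S.card - 1) (k - 3) : ℝ) * (∑ y ∈ S, V a y + ∑ y ∈ S, V b y) + 2 * (Nat.choose S.card (k - 2) : ℝ) * V a b :=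
  fun V hV hV0 hk hvalid S _ _ ha hb hab => sum_valid_insert_insert V hV hV0 hk hvalid S ha hb hab

end

end Summit.PneNP.PneNP.Theorems
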